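import Summits.Ventures.PercRepro.RankDistWindowUnimodal

/-!
# PercRepro — THE RESTRICTED VANDERMONDE INEQUALITY: a uniform `u`-subset of a two-coloured set lies in the
corridor between the splits `(q₁, q₂)` and `(p₁, p₂)` with probability at least the probability that a uniform
`(q₁ + q₂)`-subset splits exactly `(q₁, q₂)` (p9, gen 22)

`L ⊔ R`, `|L| = p₁ + q₁`, `|R| = p₂ + q₂`, `1 ≤ q_i ≤ p_i`, `n = |L| + |R|`, `q = q₁ + q₂`, `p = p₁ + p₂`;
`winFam u` the window family (`RankDistWindowSets`), `π(u) = #winFam u / C(n, u)` (`piW`). **THEOREM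
(`piW_ge`)**: `π(q) ≤ π(u)` for every `q ≤ u ≤ p`; in counts (`card_winFam_mul_choose_ge`):
`C(|L|, q₁) · C(|R|, q₂) · C(n, u) ≤ #winFam u · C(n, q)`, i.e.
`Σ_{v ∈ [max(q₁, u − p₂), min(p₁, u − q₂)]} C(|L|, v)·C(|R|, u − v) · C(n, q) ≥ C(n, u) · C(|L|, q₁)·C(|R|, q₂)`
(equality at `u = q` and `u = p`). PROOF in three regimes, `u* = min(q₁ + p₂, p₁ + q₂)`,
`u** = max(q₁ + p₂, p₁ + q₂)`: (R1) `π` is non-decreasing on `[q, u*]` (`card_winFam_mul_le_succ`: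
every superset of a window `u`-set is a window `(u + 1)`-set); (R2) `π` is non-increasing on `[u**, p]`
(`card_winFam_succ_mul_le`); (R3) on `[u*, u**]` the window is cut by one colour alone (`winFam_eq_rFam`, after
swapping the colours so that `p₂ − q₂ ≤ p₁ − q₁`: `winFam_swap`) and `π` is unimodal there
(`piR_ge_min_of_middle`); with `π(q) = π(p)` (`piW_bot_eq_top`: both are `C(|L|, q₁)C(|R|, q₂)/C(n, q)` by the
fibre count and `C(n, p) = C(n, q)`), `π(u) ≥ min(π(u*), π(u**)) ≥ min(π(q), π(p)) = π(q)`. ∎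
This is the binomial inequality behind the closure of the row (SC) under direct sums (the tight-layer shadow
profile of `M₁ ⊕ M₂` is the convolution of the profiles, and (SC) + TOP for both factors give (SC) for the sum
through exactly this inequality — proofs/P9-SERIES-g22.md §3(d)). Nothing here moves any window of the crux.
-/

namespace PercRepro.RankDist

open Finset

variable {α : Type} [DecidableEq α]

/-! ## The probability of the window and the monotone regimes -/

/-- The probability that a uniform `u`-subset of `L ∪ R` lies in the window family. -/
noncomputable def piW (L R : Finset α) (q₁ p₁ q₂ p₂ u : ℕ) : ℚ :=
  ((winFam L R q₁ p₁ q₂ p₂ u).card : ℚ) / ((L ∪ R).card.choose u : ℚ)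

/-- On the middle regime `piW = piR`. -/
lemma piW_eq_piR {L R : Finset α} (hLR : Disjoint L R) {q₁ p₁ q₂ p₂ u : ℕ} (hu₁ : q₁ + p₂ ≤ u)
    (hu₂ : u ≤ p₁ + q₂) : piW L R q₁ p₁ q₂ p₂ u = piR L R q₂ p₂ u := by
  unfold piW piR
  rw [winFam_eq_rFam hLR hu₁ hu₂]

/-- `π(u) ≤ π(u + 1)` iff `#winFam u · (n − u) ≤ #winFam (u + 1) · (u + 1)` (`u < n`). -/
lemma piW_le_succ_iff {L R : Finset α} {q₁ p₁ q₂ p₂ u : ℕ} (hu : u < (L ∪ R).card) :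
    piW L R q₁ p₁ q₂ p₂ u ≤ piW L R q₁ p₁ q₂ p₂ (u + 1) ↔
      (winFam L R q₁ p₁ q₂ p₂ u).card * ((L ∪ R).card - u)
        ≤ (winFam L R q₁ p₁ q₂ p₂ (u + 1)).card * (u + 1) := by
  unfold piW
  rw [div_le_div_iff₀ (by exact_mod_cast Nat.choose_pos hu.le) (by exact_mod_cast Nat.choose_pos hu),
    ← mul_choose_succ_le_iff hu]
  norm_cast

/-- `π(u + 1) ≤ π(u)` iff `#winFam (u + 1) · (u + 1) ≤ #winFam u · (n − u)` (`u < n`). -/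
lemma piW_succ_le_iff {L R : Finset α} {q₁ p₁ q₂ p₂ u : ℕ} (hu : u < (L ∪ R).card) :
    piW L R q₁ p₁ q₂ p₂ (u + 1) ≤ piW L R q₁ p₁ q₂ p₂ u ↔
      (winFam L R q₁ p₁ q₂ p₂ (u + 1)).card * (u + 1)
        ≤ (winFam L R q₁ p₁ q₂ p₂ u).card * ((L ∪ R).card - u) := by
  unfold piW
  rw [div_le_div_iff₀ (by exact_mod_cast Nat.choose_pos hu) (by exact_mod_cast Nat.choose_pos hu.le),
    ← mul_choose_le_mul_choose_succ_iff hu]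
  norm_cast

/-- **(R1) chained**: `π(a) ≤ π(b)` for `a ≤ b` with `b ≤ q₁ + p₂`, `b ≤ p₁ + q₂`, `b ≤ n`. -/
lemma piW_le_of_le_min {L R : Finset α} (hLR : Disjoint L R) {q₁ p₁ q₂ p₂ a b : ℕ} (hab : a ≤ b)
    (hb₁ : b ≤ q₁ + p₂) (hb₂ : b ≤ p₁ + q₂) (hbn : b ≤ (L ∪ R).card) :
    piW L R q₁ p₁ q₂ p₂ a ≤ piW L R q₁ p₁ q₂ p₂ b := by
  induction b, hab using Nat.le_induction with
  | base => exact le_rfl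
  | succ b hab ih =>
    refine (ih (by omega) (by omega) (by omega)).trans ?_
    rw [piW_le_succ_iff (by omega)]
    exact card_winFam_mul_le_succ hLR (by omega) (by omega)

/-- **(R2) chained**: `π(b) ≤ π(a)` for `a ≤ b` with `q₁ + p₂ ≤ a`, `p₁ + q₂ ≤ a`, `b ≤ n`. -/
lemma piW_le_of_max_le {L R : Finset α} (hLR : Disjoint L R) {q₁ p₁ q₂ p₂ a b : ℕ} (hab : a ≤ b)
    (ha₁ : q₁ + p₂ ≤ a) (ha₂ : p₁ + q₂ ≤ a) (hbn : b ≤ (L ∪ R).card) :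
    piW L R q₁ p₁ q₂ p₂ b ≤ piW L R q₁ p₁ q₂ p₂ a := by
  induction b, hab using Nat.le_induction with
  | base => exact le_rfl
  | succ b hab ih =>
    refine le_trans ?_ (ih (by omega))
    rw [piW_succ_le_iff (by omega)]
    exact card_winFam_succ_mul_le hLR (by omega) (by omega)

/-! ## The two ends -/

/-- At `u = q₁ + q₂` the window is the single split `(q₁, q₂)`: `#winFam q = C(|L|, q₁)·C(|R|, q₂)`. -/
lemma card_winFam_bot {L R : Finset α} (hLR : Disjoint L R) {q₁ p₁ q₂ p₂ : ℕ} (h₁ : q₁ ≤ p₁) (h₂ : q₂ ≤ p₂) :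
    (winFam L R q₁ p₁ q₂ p₂ (q₁ + q₂)).card = L.card.choose q₁ * R.card.choose q₂ := by
  have h := card_filter_card_inter_eq hLR (L := L) (R := R) (u := q₁ + q₂) (b := q₂) (by omega)
  rw [Nat.add_sub_cancel] at h
  rw [← h]
  congr 1
  ext X
  rw [mem_winFam, mem_filter, mem_powersetCard]
  constructor
  · rintro ⟨hX, hXu, h1, -, h3, -⟩
    have hsum := card_inter_add_card_inter hLR hX
    exact ⟨⟨hX, hXu⟩, by omega⟩
  · rintro ⟨⟨hX, hXu⟩, hXb⟩
    have hsum := card_inter_add_card_inter hLR hX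
    exact ⟨hX, hXu, by omega, by omega, by omega, by omega⟩

/-- At `u = p₁ + p₂` the window is the single split `(p₁, p₂)`: `#winFam p = C(|L|, p₁)·C(|R|, p₂)`. -/
lemma card_winFam_top {L R : Finset α} (hLR : Disjoint L R) {q₁ p₁ q₂ p₂ : ℕ} (h₁ : q₁ ≤ p₁) (h₂ : q₂ ≤ p₂) :
    (winFam L R q₁ p₁ q₂ p₂ (p₁ + p₂)).card = L.card.choose p₁ * R.card.choose p₂ := by
  have h := card_filter_card_inter_eq hLR (L := L) (R := R) (u := p₁ + p₂) (b := p₂) (by omega)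
  rw [Nat.add_sub_cancel] at h
  rw [← h]
  congr 1
  ext X
  rw [mem_winFam, mem_filter, mem_powersetCard]
  constructor
  · rintro ⟨hX, hXu, -, h2, -, h4⟩
    have hsum := card_inter_add_card_inter hLR hX
    exact ⟨⟨hX, hXu⟩, by omega⟩
  · rintro ⟨⟨hX, hXu⟩, hXb⟩
    have hsum := card_inter_add_card_inter hLR hX
    exact ⟨hX, hXu, by omega, by omega, by omega, by omega⟩

/-- **`π(q) = π(p)`**: both ends carry the same probability (`|L| = p₁ + q₁`, `|R| = p₂ + q₂`). -/
lemma piW_bot_eq_top {L R : Finset α} (hLR : Disjoint L R) {q₁ p₁ q₂ p₂ : ℕ} (hL : L.card = p₁ + q₁)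
    (hR : R.card = p₂ + q₂) (h₁ : q₁ ≤ p₁) (h₂ : q₂ ≤ p₂) :
    piW L R q₁ p₁ q₂ p₂ (q₁ + q₂) = piW L R q₁ p₁ q₂ p₂ (p₁ + p₂) := by
  unfold piW
  rw [card_winFam_bot hLR h₁ h₂, card_winFam_top hLR h₁ h₂]
  have hn : (L ∪ R).card = p₁ + p₂ + (q₁ + q₂) := by
    rw [card_union_of_disjoint hLR, hL, hR]
    ring
  have e1 : L.card.choose p₁ = L.card.choose q₁ := by
    rw [← Nat.choose_symm (by omega : q₁ ≤ L.card)]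
    congr 1
    omega
  have e2 : R.card.choose p₂ = R.card.choose q₂ := by
    rw [← Nat.choose_symm (by omega : q₂ ≤ R.card)]
    congr 1
    omega
  have e3 : (L ∪ R).card.choose (p₁ + p₂) = (L ∪ R).card.choose (q₁ + q₂) := by
    rw [← Nat.choose_symm (by omega : q₁ + q₂ ≤ (L ∪ R).card)]
    congr 1
    omega
  rw [e1, e2, e3]

/-! ## The symmetry of the colours -/

/-- The window family is symmetric under swapping the colours. -/
lemma winFam_swap (L R : Finset α) (q₁ p₁ q₂ p₂ u : ℕ) :
    winFam L R q₁ p₁ q₂ p₂ u = winFam R L q₂ p₂ q₁ p₁ u := by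
  ext X
  rw [mem_winFam, mem_winFam, union_comm]
  constructor
  · rintro ⟨h0, h1, h2, h3, h4, h5⟩
    exact ⟨h0, h1, h4, h5, h2, h3⟩
  · rintro ⟨h0, h1, h2, h3, h4, h5⟩
    exact ⟨h0, h1, h4, h5, h2, h3⟩

/-- `piW` is symmetric under swapping the colours. -/
lemma piW_swap (L R : Finset α) (q₁ p₁ q₂ p₂ u : ℕ) :
    piW L R q₁ p₁ q₂ p₂ u = piW R L q₂ p₂ q₁ p₁ u := by
  unfold piW
  rw [winFam_swap, union_comm]

/-! ## The theorem -/

/-- The theorem when `q₁ + p₂ ≤ p₁ + q₂` (the middle regime is cut by the `R`-counts). -/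
lemma piW_ge_of_le {L R : Finset α} (hLR : Disjoint L R) {q₁ p₁ q₂ p₂ : ℕ} (hL : L.card = p₁ + q₁)
    (hR : R.card = p₂ + q₂) (h₁ : q₁ ≤ p₁) (h₂ : q₂ ≤ p₂) (hA : q₁ + p₂ ≤ p₁ + q₂) {u : ℕ}
    (hqu : q₁ + q₂ ≤ u) (hup : u ≤ p₁ + p₂) :
    piW L R q₁ p₁ q₂ p₂ (q₁ + q₂) ≤ piW L R q₁ p₁ q₂ p₂ u := by
  have hn : (L ∪ R).card = p₁ + p₂ + (q₁ + q₂) := by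
    rw [card_union_of_disjoint hLR, hL, hR]
    ring
  have hqp := piW_bot_eq_top hLR hL hR h₁ h₂
  by_cases hlo : u ≤ q₁ + p₂
  · exact piW_le_of_le_min hLR hqu hlo (by omega) (by omega)
  by_cases hhi : p₁ + q₂ ≤ u
  · rw [hqp]
    exact piW_le_of_max_le hLR hup (by omega) (by omega) (by omega)
  -- the middle regime `q₁ + p₂ < u < p₁ + q₂`
  have hmid : min (piR L R q₂ p₂ (q₁ + p₂)) (piR L R q₂ p₂ (p₁ + q₂)) ≤ piR L R q₂ p₂ u :=
    piR_ge_min_of_middle hLR hR h₂ (by omega) (by omega) (by omega) (by omega) (by omega)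
  rw [← piW_eq_piR hLR le_rfl hA, ← piW_eq_piR hLR hA le_rfl,
    ← piW_eq_piR hLR (q₁ := q₁) (p₁ := p₁) (u := u) (by omega) (by omega)] at hmid
  have hlo' : piW L R q₁ p₁ q₂ p₂ (q₁ + q₂) ≤ piW L R q₁ p₁ q₂ p₂ (q₁ + p₂) :=
    piW_le_of_le_min hLR (by omega) le_rfl hA (by omega)
  have hhi' : piW L R q₁ p₁ q₂ p₂ (q₁ + q₂) ≤ piW L R q₁ p₁ q₂ p₂ (p₁ + q₂) := by
    rw [hqp]
    exact piW_le_of_max_le hLR (by omega) hA le_rfl (by omega)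
  exact (le_min hlo' hhi').trans hmid

/-- **THE RESTRICTED VANDERMONDE INEQUALITY (probability form)**: `L`, `R` disjoint, `|L| = p₁ + q₁`,
`|R| = p₂ + q₂`, `1 ≤ q₁ ≤ p₁`, `1 ≤ q₂ ≤ p₂`: for every `q₁ + q₂ ≤ u ≤ p₁ + p₂`,
`π(q₁ + q₂) ≤ π(u)` — a uniform `u`-subset lies in the window with probability at least the probability that a
uniform `(q₁ + q₂)`-subset splits exactly `(q₁, q₂)`. -/
theorem piW_ge {L R : Finset α} (hLR : Disjoint L R) {q₁ p₁ q₂ p₂ : ℕ} (hL : L.card = p₁ + q₁)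
    (hR : R.card = p₂ + q₂) (h₁ : q₁ ≤ p₁) (h₂ : q₂ ≤ p₂) {u : ℕ} (hqu : q₁ + q₂ ≤ u) (hup : u ≤ p₁ + p₂) :
    piW L R q₁ p₁ q₂ p₂ (q₁ + q₂) ≤ piW L R q₁ p₁ q₂ p₂ u := by
  by_cases hA : q₁ + p₂ ≤ p₁ + q₂
  · exact piW_ge_of_le hLR hL hR h₁ h₂ hA hqu hup
  · rw [piW_swap, piW_swap L R q₁ p₁ q₂ p₂ u, Nat.add_comm q₁ q₂]
    exact piW_ge_of_le hLR.symm hR hL h₂ h₁ (by omega) (by omega) (by omega)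

/-- **THE RESTRICTED VANDERMONDE INEQUALITY (counting form)**: `L`, `R` disjoint, `|L| = p₁ + q₁`, `|R| = p₂ + q₂`,
`q_i ≤ p_i`, `q₁ + q₂ ≤ u ≤ p₁ + p₂`:
`C(|L|, q₁) · C(|R|, q₂) · C(n, u) ≤ #winFam u · C(n, q₁ + q₂)`. -/
theorem card_winFam_mul_choose_ge {L R : Finset α} (hLR : Disjoint L R) {q₁ p₁ q₂ p₂ : ℕ}
    (hL : L.card = p₁ + q₁) (hR : R.card = p₂ + q₂) (h₁ : q₁ ≤ p₁) (h₂ : q₂ ≤ p₂) {u : ℕ}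
    (hqu : q₁ + q₂ ≤ u) (hup : u ≤ p₁ + p₂) :
    L.card.choose q₁ * R.card.choose q₂ * (L ∪ R).card.choose u
      ≤ (winFam L R q₁ p₁ q₂ p₂ u).card * (L ∪ R).card.choose (q₁ + q₂) := by
  have h := piW_ge hLR hL hR h₁ h₂ hqu hup
  have hn : (L ∪ R).card = p₁ + p₂ + (q₁ + q₂) := by
    rw [card_union_of_disjoint hLR, hL, hR]
    ring
  unfold piW at h
  rw [div_le_div_iff₀ (by exact_mod_cast Nat.choose_pos (by omega)) (by exact_mod_cast Nat.choose_pos (by omega)),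
    card_winFam_bot hLR h₁ h₂] at h
  exact_mod_cast h

end PercRepro.RankDist
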